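/-
Origin: expansion seat `planner-pub-hodgecm-pohl-g7-0`, handover #1(2)v3 2026-08-18T07:02:57Z (`HOME/pub-hodgecm-pohl-g7/lean/Pohl7/KillH0Descent.lean`, md5 e7395d60, 159 lines);
landed by the gen-7 packager in gate run 25 as `HodgeCM/Model/KillH0Descent.lean` (import ^import Pohl7\.KillH0\b→import HodgeCM.Model.KillH0 ×1).
-/
/-
Copyright: pub-hodgecm formalisation cell (harness21, 2026). New file (not vendored).
Origin: HOME/pub-hodgecm-pohl-g7/lean/Pohl7/KillH0Descent.lean — session planner-pub-hodgecm-pohl-g7-0 (unit pub-hodgecm-pohl-g7),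
EXPANSION part (b) `PohlmannSpan`, generation 7.  Intended final place: `HodgeCM/Model/KillH0Descent.lean`
(module `HodgeCM.Model.KillH0Descent`; the import `Pohl7.KillH0` becomes `HodgeCM.Model.KillH0`).
-/
import Summits.HodgeConjecture.HodgeCM.Model.KillH0
import Summits.HodgeConjecture.HodgeCM.StubTree.Qw8GysinDescent
import Summits.HodgeConjecture.HodgeCM.Proofs.Pohlmann.DegreeZeroGeneric

/-!
# Killing `H⁰`, II: the transform preserves F7d and refutes every degree-`0` input

Continuation of `HodgeCM.Model.KillH0` (the universe transform `U ↦ U♭ := U.killH0`, `H⁰ ↦ 0`, all other data kept)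
for the statements that live downstream of `HodgeCM.StubTree.Qw8GysinDescent` / `HodgeCM.Proofs.Pohlmann.DegreeZeroGeneric`:

* `KillH0.fact_gysinDescent` — F7d `Fact_gysinDescent` (injectivity and descent of algebraicity along boxing with a nonzero
  top class of the complementary block) TRANSFERS from `U` to `U♭`, given M2 `Fact_pull_comp` and `H0Rigid` in `U`
  (needed only to read a `U♭`-block pair as a `U`-block pair in degree `0`);
* `KillH0.not_fact_H0_rank`, `KillH0.not_cmProdH0Nontrivial`, `KillH0.not_cmProdConnected`, `KillH0.not_fact_weightDual`,
  `KillH0.not_pohlmannTheorem31All`, `KillH0.not_unitLaw` — in `U♭` EVERY form of the degree-`0` input is FALSE: `dim H⁰ = 1`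
  (`Fact_H0_rank`), `H⁰(A′) ≠ 0` (`CMProdH0Nontrivial`), `dim H⁰(A′) = 1` (`CMProdConnected`), F6 `Fact_weightDual` (which
  implies `CMProdH0Nontrivial` under `ModelAxioms` + N1, pohl-g5), Gao–Ullmo Thm 3.1 at `p = 0` (`PohlmannTheorem31All`), and
  the unit law `1 ∪ z = z` of a unit-class family (clause (ii) of qw8-g4's F-H0 `Fact_unitH0`, given M22 in `U`);
* `KillH0.hc_iff`, `KillH0.hc_of_hc`, `KillH0.hc_cm` — the Hodge conjecture `HC X` / COR-CM `HC_CM` TRANSFER from `U` to `U♭`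
  (codimension `0` is vacuous in `U♭`): the degree-`0` input is orthogonal to COR-CM.

Together with `KillH0.modelAxioms` and the N1–N4 / F4 / F5 / `Fact_dimProd` transfers of `HodgeCM.Model.KillH0` this gives,
for every universe `U` with `ModelAxioms`, `H0Rigid`, `TrZero`, N1, N2, N4, F4, F5, F7d, `Fact_dimProd` — e.g. the exterior
toy universe, `HodgeCM.Model.Toy.KillH0` — a universe `U♭` satisfying the COMPLETE generic hypothesis list of the trace-free
headline theorems (`Universe.qw8Sufficiency_of_descentFacts`, `Assembly.COR_CM_of_descentFacts`: `ModelAxioms`, N1–N4, F4, F5,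
F7d, `Fact_dimProd`) in which `H⁰` of every variety is `0`.  Hence NONE of the degree-`0` statements above is a consequence
of that list: the degree-`0` input of `PohlmannTheorem31All` (isolated as `CMProdConnected` by pohl-g4 and as
`Fact_H0_rank` / `CMProdH0Nontrivial` by pohl-g6) is GENUINELY INDEPENDENT of the trace-free generic facts — answering the
question left open in pohl-g6's `DegreeZeroGeneric` ("whether `H⁰ ≠ 0` follows from the F6-free, trace-free list").
(With the monomial-basis facts F7 `Fact_gysin` + `Fact_trTopCM` instead of F7d it DOES follow —
`cmProdConnected_of_generic`, pohl-g6 — but `Fact_trTopCM` fails in every exterior retrace, `HodgeCM.Model.Toy.TrTop`.)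

Everything here is KERNEL-PROVED structure theory of the axiom system; nothing is cited, no hypothesis is named after
PerL / [QW8] / the 2001 programme.
-/

noncomputable section

open scoped TensorProduct

namespace HodgeCM

open Literature.AlgebraicGeometry.Motives (CMType)
open HodgeCM.Pohlmann

namespace Universe

variable {U : Universe}

namespace KillH0

/-! ## 1. F7d transfers -/

/-- (Ported verbatim from the HodgeCMPerL package; no docstring in the source.) -/
theorem toU_ne_zero {X : U.Var} {k : ℕ} {x : U.killH0.Coh X k} (hx : x ≠ 0) : toU X k x ≠ 0 := by
  intro h
  apply hx
  have h' := congrArg (ofU X k) h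
  rwa [ofU_toU, map_zero] at h'

set_option smartUnfolding false in
/-- **F7d `Fact_gysinDescent` transfers to `U♭`** (given M2 and `H0Rigid` in `U`, to transport block pairs). -/
theorem fact_gysinDescent (h2 : U.Fact_pull_comp) (h0 : U.H0Rigid) (h : U.Fact_gysinDescent) :
    U.killH0.Fact_gysinDescent := by
  intro F n m Ξ pA pB hbp ω hω
  have hbp' : U.IsBlockPair F Ξ pA pB := isBlockPair_of_killH0 h2 h0 hbp
  obtain ⟨ha, hb⟩ := h F n m Ξ pA pB hbp'
    (toU (U := U) (U.killH0.cmProd F (blkB Ξ)) (2 * U.dim (U.killH0.cmProd F (blkB Ξ))) ω) (toU_ne_zero (U := U) hω)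
  refine ⟨fun k e he => ?_, fun p e he => ?_⟩
  · have h1 := congrArg (toU (U := U) (U.killH0.cmProd F Ξ) (k + 2 * U.dim (U.killH0.cmProd F (blkB Ξ)))) he
    rw [toU_cup, toU_pull, toU_pull, map_zero] at h1
    have h3 := ha k (toU (U := U) (U.killH0.cmProd F (blkA Ξ)) k e) h1
    exact toU_injective (U := U) _ k (h3.trans (map_zero _).symm)
  · rw [mem_alg_iff, toU_castCoh, toU_cup, toU_pull, toU_pull] at he
    exact (mem_alg_iff (U := U) _ p e).mpr (hb p (toU (U := U) (U.killH0.cmProd F (blkA Ξ)) (2 * p) e) he)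

/-! ## 2. Every form of the degree-`0` input fails in `U♭` -/

/-- `Fact_H0_rank` (`dim H⁰(X) = 1` for all `X`) fails in `U♭`. -/
theorem not_fact_H0_rank : ¬ U.killH0.Fact_H0_rank := by
  intro h
  have h1 := h (U.cmAV cyclo7 (stdCMType cyclo7))
  rw [finrank_coh_zero] at h1
  exact zero_ne_one h1

/-- `CMProdH0Nontrivial` (`H⁰(A′) ≠ 0`) fails in `U♭`. -/
theorem not_cmProdH0Nontrivial : ¬ U.killH0.CMProdH0Nontrivial := by
  intro h
  haveI := h cyclo7 0 (fun _ => stdCMType cyclo7)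
  exact false_of_nontrivial_of_subsingleton (U.killH0.Coh (U.killH0.cmProd (n := 0) cyclo7 fun _ => stdCMType cyclo7) 0)

/-- `CMProdConnected` (`dim H⁰(A′) = 1`) fails in `U♭`. -/
theorem not_cmProdConnected : ¬ U.killH0.CMProdConnected := fun h =>
  not_cmProdH0Nontrivial (cmProdH0Nontrivial_of_connected h)

/-- F6 `Fact_weightDual` fails in `U♭` as soon as `U♭` has `ModelAxioms` and N1 (pohl-g5: F6 ⇒ `H⁰(A′) ≠ 0`). -/
theorem not_fact_weightDual (M : U.killH0.ModelAxioms) (hN1 : U.killH0.Fact_cupExterior) :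
    ¬ U.killH0.Fact_weightDual := fun h6 =>
  not_cmProdH0Nontrivial (cmProdH0Nontrivial_of_weightDual M hN1 h6)

/-- Gao–Ullmo Thm 3.1 for all `p ≥ 0` (`PohlmannTheorem31All`) fails in `U♭`: at `p = 0` it counts one Hodge weight,
but `B⁰ ⊆ H⁰ = 0`. -/
theorem not_pohlmannTheorem31All : ¬ U.killH0.PohlmannTheorem31All := by
  intro h
  have h1 := (h cyclo7 cyclo7_isGalois 0 (fun _ => stdCMType cyclo7) 0).2
  rw [card_isHodgeWeight_zero, Module.finrank_zero_of_subsingleton] at h1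
  exact zero_ne_one h1

/-- **The Hodge conjecture transfers to `U♭`.**  `HC X` in `U♭` is `HC X` in `U` in positive codimension and vacuous in
codimension `0` (`H⁰ = 0`).  In particular COR-CM `HC_CM` holds in `U♭` whenever it holds in `U` — although EVERY form of the
degree-`0` input fails in `U♭`: the degree-`0` input is orthogonal to COR-CM (it is not among the hypotheses of
`Assembly.COR_CM_of_descentFacts`; it enters only the citation form `PohlmannTheorem31All` of Gao–Ullmo Thm 3.1 at `p = 0`
and qw8-g4's reduction of F7d to F-H0 + F7d-B). -/
theorem hc_iff (X : U.Var) : U.killH0.HC X ↔ ∀ p : ℕ, 0 < p → U.hodgeClassesOf X p ≤ U.alg X p := by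
  constructor
  · intro h p hp
    obtain ⟨q, rfl⟩ := Nat.exists_eq_succ_of_ne_zero hp.ne'
    exact h (q + 1)
  · intro h p
    cases p with
    | zero => intro x _; exact (Submodule.mem_bot ℚ).mpr (Subsingleton.elim x 0)
    | succ q => exact h (q + 1) q.succ_pos

/-- (Ported verbatim from the HodgeCMPerL package; no docstring in the source.) -/
theorem hc_of_hc {X : U.Var} (h : U.HC X) : U.killH0.HC X :=
  (hc_iff X).mpr fun p _ => h p

/-- (Ported verbatim from the HodgeCMPerL package; no docstring in the source.) -/
theorem hc_cm (h : U.HC_CM) : U.killH0.HC_CM := fun X hX => hc_of_hc (h X hX)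

/-- **No unit classes in `U♭`.**  The unit law `1_X ∪ z = z` (up to the degree transport `l = 0 + l`) — clause (ii) of
qw8-g4's F-H0 `Fact_unitH0` (run 25; Hatcher §3.2: the identity `1 ∈ H⁰(X; R)` of the cohomology ring) — FAILS in `U♭` for
every candidate family `one`, as soon as the source universe has M22 (`H¹` of a CM abelian variety has rank `[K:ℚ] > 0`):
in `U♭` every cup product with a degree-`0` factor is `0`.  Stated over the unit-law clause itself (the weakest form), so
that `¬ U♭.Fact_unitH0` is immediate once that definition is in the tree: F-H0, too, is independent of the trace-free list. -/
theorem not_unitLaw (h22 : U.Fact_H1_rank) :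
    ¬ ∃ one : ∀ X : U.killH0.Var, U.killH0.Coh X 0,
      ∀ (X : U.killH0.Var) (l : ℕ) (z : U.killH0.Coh X l),
        U.killH0.cup X 0 l (one X) z = U.killH0.castCoh X (Nat.zero_add l).symm z := by
  rintro ⟨one, hone⟩
  have hpos : 0 < Module.finrank ℚ (U.Coh (U.cmAV cyclo7 (stdCMType cyclo7)) 1) := by
    rw [h22]
    exact Module.finrank_pos
  obtain ⟨z, hz⟩ := Module.finrank_pos_iff_exists_ne_zero.mp hpos
  have h1 := hone (U.cmAV cyclo7 (stdCMType cyclo7)) 1 z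
  have h0 : U.killH0.cup (U.cmAV cyclo7 (stdCMType cyclo7)) 0 1 (one _) z = 0 := rfl
  rw [h0] at h1
  exact hz ((LinearEquiv.map_eq_zero_iff _).mp h1.symm)

end KillH0

end Universe

end HodgeCM

end
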